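import Literature.NumberTheory.EllipticCurves.Kato2004.ZetaBodyLayerValuesTwoProofs
import Summits.BirchSwinnertonDyer.BirchSwinnertonDyer.Theorems.CyclotomicUntwistRohrlichAtLevel
import HarnessLib

/-!
# Route ByReductionTypeAtTwo, crux `AdditiveRankZeroAtTwo` (stmt-BirchSwinnertonDyer-19098), child C4″
# (stmt-BirchSwinnertonDyer-22618): hypothesis (i) of Kato's Thm. 13.4 at `p = 2` — a NON-ZERO genuine `2`-adic
# Euler-system class in every pinned `𝐇¹_Γ(T₂W)`, in EVERY analytic rank and at ANY reduction type at `2`, for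
# `W[2]` irreducible — modulo the ONE construction fact `Kato2004.exists_eulerSystem_expStar_values`, with Rohrlich's
# theorem FED FROM THE KERNEL (`PSRohrlichAtLevel.rohrlich_primePow_of_isNewformOf`, any prime, `2 ∣ N` allowed)

Cell `bsd-2adic` (run/shared/lean/pub/bsd-2adic/), seat `bsd-2adic-addL2x` GEN 20 (repair-census entry R-B83 (2)+(3)).
The Literature theorem `Kato2004.exists_isEulerSystemClassTwo_ne_zero_of_rohrlich` (`Kato2004/ZetaBodyLayerValuesTwoProofs.lean`,
p743751) proves Kato's step «`L(f, χ, 1) ≠ 0` for almost all characters `χ` of `Gal(ℚ(ζ_{2^∞})/ℚ)` ⇒ `z_γ ≠ 0`» (proof of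
Thm. 12.5 (1), pp. 221–222) at `p = 2` from Kato's own guarded datum, taking Rohrlich's finiteness as a displayed hypothesis
`hR`. On the Summits side that hypothesis is a KERNEL theorem for EVERY prime — `PSRohrlichAtLevel.rohrlich_primePow_of_isNewformOf`
(`Theorems/CyclotomicUntwistRohrlichAtLevel.lean`, cell bsd-wall: Rohrlich's argument with the Atkin–Lehner involution at the
prime-to-`p` part of the level, so `p ∣ N` — additive or multiplicative `2` — is covered). Feeding it gives, for the additive-at-`2`
blocks of this crux (and for every other reduction type):

* `AddKatoTwo.exists_isEulerSystemClassTwo_ne_zero` — for every elliptic `W/ℚ` with `W[2]` irreducible, every newform `f` of `W`,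
  the cyclotomic `ℤ₂`-extension `κ` and every pin `I : Kato2004.IwasawaH1Data W 2 κ γ`: GRANTED ONLY
  `Kato2004.exists_eulerSystem_expStar_values` (Kato (8.1.3)/Ex. 13.3 with Thm. 9.7 and Thm. 6.6 (1) — no parity or reduction
  hypothesis), there is `s ∈ 𝐇¹_Γ(T₂W)` with `Kato2004.IsEulerSystemClassTwo W hκ I s ∧ s ≠ 0` — the binder «a non-zero genuine
  `2`-adic Euler-system class» (hypothesis (i) of Thm. 13.4) of the tree's `Kato2004.thm13_4_two_lengthAt_fineSelmerDual_le_of_isEulerSystemClassTwo`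
  and of its 2-adic consumers, now in EVERY analytic rank (the rank-`0` case `L(W,1) ≠ 0` was
  `SignedKatoOffTwo.ESClassTwo.exists_isEulerSystemClassTwo_ne_zero`);
* `AddKatoTwo.nontrivial_iwasawaH1_two`, `AddKatoTwo.one_le_rank_iwasawaH1_two` — `𝐇¹_Γ(T₂W) ≠ 0` and
  `1 ≤ rank_Λ 𝐇¹_Γ(T₂W)` ((12.2.2) at `p = 2`) under the same single construction fact.

HONEST FRAMING (D-0036/D-0054): theorems only; CONDITIONAL on the named construction fact `Kato2004.exists_eulerSystem_expStar_values`
(def:Prop, hypothesis BY NAME, never asserted; the gate records a conditional result); closes nothing; nothing booked; the crux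
19098 / C4″ 22618 signatures are untouched; BSD is not proved by any of this.

References: [Kato2004Asterisque] Thm. 12.5 (1) and proof (pp. 221–222), (12.2.2) (p. 220), Thm. 13.4 (i) (p. 226), Ex. 13.3
(p. 225); [RohrlichInventiones1984] Theorem p. 409 (and Invent. Math. 97 (1989) for `p ∣ N`); tree
`Kato2004/ZetaBodyLayerValuesTwoProofs.lean` (p743751), `Theorems/CyclotomicUntwistRohrlichAtLevel.lean`.
-/

set_option autoImplicit false
-- the summit's namespace `Summit.BirchSwinnertonDyer.BirchSwinnertonDyer` (Sub = Summit) trips `dupNamespace`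
set_option linter.dupNamespace false

noncomputable section

namespace Summit.BirchSwinnertonDyer.BirchSwinnertonDyer.Theorems.AddKatoTwo

open Field CongruenceSubgroup WeierstrassCurve Literature.NumberTheory.EllipticCurves
  Literature.NumberTheory.EllipticCurves.ModularForms Literature.NumberTheory.EllipticCurves.Kato2004

variable (W : WeierstrassCurve ℚ) [W.IsElliptic] [ContinuousSMul ℤ_[2] (W.tateModule 2)]
  [Module.Free ℤ_[2] (W.tateModule 2)] [Module.Finite ℤ_[2] (W.tateModule 2)] {κ : ZpExtension ℚ 2}
  {γ : absoluteGaloisGroup ℚ} (I : Kato2004.IwasawaH1Data W 2 κ γ)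

/-- **Hypothesis (i) of Kato's Thm. 13.4 at `p = 2`, every analytic rank, every reduction type, modulo the ONE construction
fact.** For `W/ℚ` elliptic with `W[2]` irreducible (structure facts of `T₂W` as instance binders), `f` a newform of `W`, `κ`
the cyclotomic `ℤ₂`-extension and any pin `I`: GRANTED `Kato2004.exists_eulerSystem_expStar_values`, some `s ∈ 𝐇¹_Γ(T₂W)` is a
genuine `2`-adic Euler-system class (`Kato2004.IsEulerSystemClassTwo`) and `s ≠ 0`. Rohrlich's finiteness for `f` at `2` is
the KERNEL theorem `PSRohrlichAtLevel.rohrlich_primePow_of_isNewformOf` (any prime, `2 ∣ N` allowed). Conditional on the named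
construction fact `hES`. [cite: Kato2004Asterisque, Thm. 12.5 (1) and proof (pp. 221–222), Thm. 13.4 (i) (p. 226), Ex. 13.3 (p. 225)]
[cite: RohrlichInventiones1984, Theorem (p. 409)] -/
theorem exists_isEulerSystemClassTwo_ne_zero (hκ : κ.IsCyclotomic) (hES : Kato2004.exists_eulerSystem_expStar_values)
    (hirr : W.HasIrreducibleModPGaloisRep 2) {N : ℕ} [NeZero N] (f : CuspForm (Gamma0 N) 2)
    (hf : IsNewformOf W f) :
    ∃ s : I.H, Kato2004.IsEulerSystemClassTwo W hκ I s ∧ s ≠ 0 :=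
  Kato2004.exists_isEulerSystemClassTwo_ne_zero_of_rohrlich W I hκ hES hirr f hf
    (PSRohrlichAtLevel.rohrlich_primePow_of_isNewformOf (p := 2) hf)

/-- **`𝐇¹_Γ(T₂W) ≠ 0`** for `W[2]` irreducible, `κ` cyclotomic, any pin `I`, modulo the construction fact alone (Rohrlich fed
from the kernel). [cite: Kato2004Asterisque, Thm. 12.5 (1) (pp. 221–222), Prop. 13.7 (p. 227)] -/
theorem nontrivial_iwasawaH1_two (hκ : κ.IsCyclotomic) (hES : Kato2004.exists_eulerSystem_expStar_values)
    (hirr : W.HasIrreducibleModPGaloisRep 2) {N : ℕ} [NeZero N] (f : CuspForm (Gamma0 N) 2)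
    (hf : IsNewformOf W f) : Nontrivial I.H :=
  Kato2004.nontrivial_iwasawaH1_two_of_expStar_values_of_rohrlich W I hκ hES hirr f hf
    (PSRohrlichAtLevel.rohrlich_primePow_of_isNewformOf (p := 2) hf)

/-- **`1 ≤ rank_Λ 𝐇¹_Γ(T₂W)`** — Kato (12.2.2) at `p = 2` — for `W[2]` irreducible, `κ` cyclotomic with topological generator
`γ`, any pin `I`, modulo the construction fact alone (Rohrlich fed from the kernel; `𝐇¹` is `Λ`-torsion free,
`IwasawaH1Data.isTorsionFree`). [cite: Kato2004Asterisque, §12.2 (12.2.2) (p. 220), Thm. 12.4 (2) (p. 221), Thm. 12.5 (1) (pp. 221–222)] -/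
theorem one_le_rank_iwasawaH1_two (hκ : κ.IsCyclotomic) (hγ : κ.IsTopGenerator γ)
    (hES : Kato2004.exists_eulerSystem_expStar_values) (hirr : W.HasIrreducibleModPGaloisRep 2) {N : ℕ} [NeZero N]
    (f : CuspForm (Gamma0 N) 2) (hf : IsNewformOf W f) :
    1 ≤ Module.rank (IwasawaAlgebra 2) I.H :=
  Kato2004.one_le_rank_iwasawaH1_two_of_expStar_values_of_rohrlich W I hκ hγ hES hirr f hf
    (PSRohrlichAtLevel.rohrlich_primePow_of_isNewformOf (p := 2) hf)

end Summit.BirchSwinnertonDyer.BirchSwinnertonDyer.Theorems.AddKatoTwo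

end
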